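/-
Copyright (c) 2026 the pub-hodgecm-mathlib formalisation cell (harness21).  Prover seat hodgecm-mathlib-F0P3a-p01 (g22), 2026-09-02.
-/
import Summits.HodgeConjecture.HodgeConjecture.Theorems.F0P3cStCharTSUpTrU2BoxProduct  -- ★-to-be (B2b) FILE 2 (this seat): shape algebra `coe_mul_of_coe_eq_upper∕_lower`, `coe_inv_of_coe_eq_upper∕_lower`, `shape_of_coe_eq_*` (brings ★ (B2a) `injOn_nbar_torus_unipotent`, ★ U2Alg)
import HarnessLib

/-!
# F0 · P3c · line LH6 «StCharTS» — ROAD «UP-TR» ∕ «JAC-LOC₂», brick (B2b) FILE 3 «BOX PRODUCT: UNIQUE FACTORISATION»: the matrix-shape boxes of `U(σ, Φ₂)(K)` lie in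
# `N̄ = w₀Nw₀`, `M`, `N`, hence `(n̄, m, n) ↦ n̄ m n` is injective on `N̄[r₁] × M_δ × N[r₂]` [Casselman1995, Prop. 1.4.4; BruhatTits1972, (4.4.4)]

Cell `pub/hodgecm-mathlib`, crux H413 = `stmt-HodgeConjecture-24833` (lane `--supports … --as helper`); seat F0P3a-p01 (g22); sub-road «JAC-LOC₂» (sub-dealer LH7-p02 (g8)), brick (B2b).
THEOREMS ONLY; ★-only imports.  The `hinj` input of the index tower ★ `Literature.GroupTheory.ProductSubgroupIndex.relIndex_tripleProduct_eq` ∕ `measure_tripleProduct_eq`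
((B2b) FILE 1) at the MATRIX-SHAPE carriers of (B2b) FILE 2 `F0P3cStCharTSUpTrU2BoxProduct.exists_subgroup_coe_eq_boxProduct` and of the (B5)∕(B5-M) letters:
`N̄[r] = {x | ↑↑x = !![1, 0; (↑↑x) 1 0, 1] ∧ v ((↑↑x) 1 0) ≤ r}`, `M_δ = {m | m ∈ torusU σ J ∧ ↑m ∈ congruenceGL 2 δ}`, `N[r] = {x | ↑↑x = !![1, (↑↑x) 0 1; 0, 1] ∧ v ((↑↑x) 0 1) ≤ r}`.
* the three boxes AS SUBGROUPS of `U′`, every radius: `exists_subgroup_coe_eq_lowerBox ∕ _upperBox ∕ _torusLevel` (+ `lowerBox_mono`, `upperBox_mono`, `le_of_coe_eq_of_subset`) — the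
  `A ⊇ A₀`, `C`, `B ⊇ B₀` of the index tower;
* `mem_unipotentU_of_coe_eq_upper` (an upper shape lies in `N`), `mem_map_conj_weylLongU_of_coe_eq_lower` (a lower shape lies in `N̄ = w₀ N w₀`, ★ U2Alg `coe_weylConj_apply`),
  **`injOn_boxProduct`** — `Set.InjOn (fun p => p.1 * p.2.1 * p.2.2) (N̄[r₁] ×ˢ M_δ ×ˢ N[r₂])` for ALL radii (★ (B2a) `injOn_nbar_torus_unipotent` restricted by `Set.InjOn.mono`).
HONEST LABEL (ROAD «UP-TR», LEAD T14-21 (7)): count-neutral; block consequents 11 → 10 → 9 only at the rider editions; organs 2 = 2; h413 registry untouched; HC_CM is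
proved only modulo the printed citations (2 remaining named inputs: hLiu418 = `stmt-HodgeConjecture-24832`, h413 = `stmt-HodgeConjecture-24833`) until rung 0 closes.

## References
* [Casselman1995] W. Casselman, *Introduction to the theory of admissible representations of `p`-adic reductive groups* (1995), Prop. 1.4.4.
* [BruhatTits1972] F. Bruhat, J. Tits, *Groupes réductifs sur un corps local I*, Publ. Math. IHÉS 41 (1972), (4.4.4).
* [Rogawski1990] J. D. Rogawski, *Automorphic Representations of Unitary Groups in Three Variables*, Ann. of Math. Stud. 123 (1990), §1.10 p. 9.
-/

set_option autoImplicit false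
-- the mandated namespace has the single-problem summit's repeated segment (`HodgeConjecture.HodgeConjecture`)
set_option linter.dupNamespace false

open Matrix ValuativeRel
open Literature.NumberTheory.Automorphic Literature.NumberTheory.Automorphic.UnitaryGroup
open Summit.HodgeConjecture.HodgeConjecture.Cruxes.H413.F0P3cIwahoriDatumU2
open Summit.HodgeConjecture.HodgeConjecture.Cruxes.H413.F0P3cStCharTSUpTrU2Levels
open Summit.HodgeConjecture.HodgeConjecture.Cruxes.H413.F0P3cStCharTSUpTrU2BoxProduct
open scoped MatrixGroups Pointwise

namespace Summit.HodgeConjecture.HodgeConjecture.Cruxes.H413.F0P3cStCharTSUpTrU2BoxProductIndex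

section Valued

variable {K : Type*} [Field K] [ValuativeRel K] (σ : K →+* K) {J : Matrix (Fin 2) (Fin 2) K} (hJ : J = (StdForm.antidiagonal 2).over K)

/-! ## The boxes lie in `N̄ = w₀Nw₀`, `M`, `N`; unique factorisation on the box product -/

omit [ValuativeRel K] in
/-- An upper shape is a member of `N = unipotentU σ J`. [cite: Rogawski1990, §1.10 p. 9] -/
theorem mem_unipotentU_of_coe_eq_upper {x : ↥(unitaryGroupOfForm σ J)} {y : K} (hx : ((x : GL (Fin 2) K) : Matrix (Fin 2) (Fin 2) K) = !![1, y; 0, 1]) :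
    x ∈ unipotentU σ J := by
  rw [mem_unipotentU_iff, hx]
  refine ⟨fun i j hij => ?_, fun i => ?_⟩
  · fin_cases i <;> fin_cases j <;> simp_all
  · fin_cases i <;> simp

include hJ in
omit [ValuativeRel K] in
/-- A lower shape is a member of `N̄ = w₀ N w₀` (`x = w₀ (w₀ x w₀) w₀⁻¹` and `w₀ ū(z) w₀ = u(z)`; ★ `coe_weylConj_apply`, `weylLongU_inv_eq`). [cite: Rogawski1990, §1.10 p. 9] -/
theorem mem_map_conj_weylLongU_of_coe_eq_lower {x : ↥(unitaryGroupOfForm σ J)} {z : K} (hx : ((x : GL (Fin 2) K) : Matrix (Fin 2) (Fin 2) K) = !![1, 0; z, 1]) :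
    x ∈ ((borelTriple σ J hJ).N).map (MulAut.conj (weylLongU σ hJ)).toMonoidHom := by
  have hwinv : (weylLongU σ hJ)⁻¹ = weylLongU σ hJ := weylLongU_inv_eq σ hJ
  refine Subgroup.mem_map.2 ⟨weylLongU σ hJ * x * weylLongU σ hJ, ?_, ?_⟩
  · rw [borelTriple_N]
    refine mem_unipotentU_of_coe_eq_upper σ (y := z) ?_
    ext i j
    rw [coe_weylConj_apply σ hJ x i j, hx]
    fin_cases i <;> fin_cases j <;> rfl
  · have hw1 : weylLongU σ hJ * weylLongU σ hJ = 1 := mul_eq_one_iff_eq_inv.2 hwinv.symm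
    rw [MulEquiv.coe_toMonoidHom, MulAut.conj_apply, hwinv]
    simp only [← mul_assoc]
    rw [hw1, one_mul, mul_assoc, hw1, mul_one]

include hJ in
/-- **Unique factorisation on the box product** `N̄[r₁] × M_δ × N[r₂]` (★ (B2a) `injOn_nbar_torus_unipotent` restricted through §5's memberships) — the `hinj` of ★
`Literature.GroupTheory.ProductSubgroupIndex.relIndex_tripleProduct_eq`. [cite: Casselman1995, Prop. 1.4.4] [cite: BruhatTits1972, (4.4.4)] -/
theorem injOn_boxProduct {δ r₁ r₂ : ValueGroupWithZero K} :
    Set.InjOn (fun p : ↥(unitaryGroupOfForm σ J) × (↥(unitaryGroupOfForm σ J) × ↥(unitaryGroupOfForm σ J)) => p.1 * p.2.1 * p.2.2)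
      ({x : ↥(unitaryGroupOfForm σ J) | ((x : GL (Fin 2) K) : Matrix (Fin 2) (Fin 2) K) = !![1, 0; ((x : GL (Fin 2) K) : Matrix (Fin 2) (Fin 2) K) 1 0, 1] ∧
          valuation K (((x : GL (Fin 2) K) : Matrix (Fin 2) (Fin 2) K) 1 0) ≤ r₁} ×ˢ
        ({m : ↥(unitaryGroupOfForm σ J) | m ∈ torusU σ J ∧ (m : GL (Fin 2) K) ∈ congruenceGL 2 δ} ×ˢ
          {x : ↥(unitaryGroupOfForm σ J) | ((x : GL (Fin 2) K) : Matrix (Fin 2) (Fin 2) K) = !![1, ((x : GL (Fin 2) K) : Matrix (Fin 2) (Fin 2) K) 0 1; 0, 1] ∧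
            valuation K (((x : GL (Fin 2) K) : Matrix (Fin 2) (Fin 2) K) 0 1) ≤ r₂})) := by
  refine (injOn_nbar_torus_unipotent σ hJ).mono ?_
  refine Set.prod_mono (fun x hx => mem_map_conj_weylLongU_of_coe_eq_lower σ hJ hx.1) (Set.prod_mono (fun m hm => ?_) (fun x hx => ?_))
  · rw [SetLike.mem_coe, borelTriple_M]; exact hm.1
  · rw [SetLike.mem_coe, borelTriple_N]; exact mem_unipotentU_of_coe_eq_upper σ hx.1

/-! ## The three boxes as subgroups of `U′` (matrix-shape spelling, every radius) -/

include hJ in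
/-- **The lower box `N̄[r]` is a subgroup of `U′`** for EVERY radius `r` (ultrametric closure; `ū(z)⁻¹ = ū(−z)`), stated existentially with its carrier in the matrix-shape spelling.
[cite: Casselman1995, Prop. 1.4.4] [cite: Rogawski1990, §1.10 p. 9] -/
theorem exists_subgroup_coe_eq_lowerBox (r : ValueGroupWithZero K) :
    ∃ A : Subgroup ↥(unitaryGroupOfForm σ J), (A : Set ↥(unitaryGroupOfForm σ J)) =
      {x : ↥(unitaryGroupOfForm σ J) | ((x : GL (Fin 2) K) : Matrix (Fin 2) (Fin 2) K) = !![1, 0; ((x : GL (Fin 2) K) : Matrix (Fin 2) (Fin 2) K) 1 0, 1] ∧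
        valuation K (((x : GL (Fin 2) K) : Matrix (Fin 2) (Fin 2) K) 1 0) ≤ r} := by
  refine ⟨{ carrier := _, mul_mem' := ?_, one_mem' := ?_, inv_mem' := ?_ }, rfl⟩
  · rintro a a' ⟨ha, hva⟩ ⟨ha', hva'⟩
    have hm := coe_mul_of_coe_eq_lower σ ha ha'
    refine ⟨(shape_of_coe_eq_lower σ hm).1, ?_⟩
    rw [(shape_of_coe_eq_lower σ hm).2]
    exact (Valuation.map_add _ _ _).trans (max_le hva hva')
  · have h1 : (((1 : ↥(unitaryGroupOfForm σ J)) : GL (Fin 2) K) : Matrix (Fin 2) (Fin 2) K) = 1 := by rw [Subgroup.coe_one, Units.val_one]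
    refine ⟨?_, ?_⟩
    · rw [h1]; ext i j; fin_cases i <;> fin_cases j <;> simp
    · rw [h1]; simp
  · rintro a ⟨ha, hva⟩
    have hm := coe_inv_of_coe_eq_lower σ hJ ha
    refine ⟨(shape_of_coe_eq_lower σ hm).1, ?_⟩
    rw [(shape_of_coe_eq_lower σ hm).2, Valuation.map_neg]; exact hva

include hJ in
/-- **The upper box `N[r]` is a subgroup of `U′`** for EVERY radius `r`. [cite: Casselman1995, Prop. 1.4.4] [cite: Rogawski1990, §1.10 p. 9] -/
theorem exists_subgroup_coe_eq_upperBox (r : ValueGroupWithZero K) :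
    ∃ B : Subgroup ↥(unitaryGroupOfForm σ J), (B : Set ↥(unitaryGroupOfForm σ J)) =
      {x : ↥(unitaryGroupOfForm σ J) | ((x : GL (Fin 2) K) : Matrix (Fin 2) (Fin 2) K) = !![1, ((x : GL (Fin 2) K) : Matrix (Fin 2) (Fin 2) K) 0 1; 0, 1] ∧
        valuation K (((x : GL (Fin 2) K) : Matrix (Fin 2) (Fin 2) K) 0 1) ≤ r} := by
  refine ⟨{ carrier := _, mul_mem' := ?_, one_mem' := ?_, inv_mem' := ?_ }, rfl⟩
  · rintro a a' ⟨ha, hva⟩ ⟨ha', hva'⟩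
    have hm := coe_mul_of_coe_eq_upper σ ha ha'
    refine ⟨(shape_of_coe_eq_upper σ hm).1, ?_⟩
    rw [(shape_of_coe_eq_upper σ hm).2]
    exact (Valuation.map_add _ _ _).trans (max_le hva hva')
  · have h1 : (((1 : ↥(unitaryGroupOfForm σ J)) : GL (Fin 2) K) : Matrix (Fin 2) (Fin 2) K) = 1 := by rw [Subgroup.coe_one, Units.val_one]
    refine ⟨?_, ?_⟩
    · rw [h1]; ext i j; fin_cases i <;> fin_cases j <;> simp
    · rw [h1]; simp
  · rintro a ⟨ha, hva⟩
    have hm := coe_inv_of_coe_eq_upper σ hJ ha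
    refine ⟨(shape_of_coe_eq_upper σ hm).1, ?_⟩
    rw [(shape_of_coe_eq_upper σ hm).2, Valuation.map_neg]; exact hva

/-- **The torus level `M_δ` is a subgroup of `U′`** (it is `torusU σ J ⊓ K_δ.comap U′.subtype`, carrier spelled as in the letters). [cite: Casselman1995, Prop. 1.4.4] -/
theorem exists_subgroup_coe_eq_torusLevel (δ : ValueGroupWithZero K) :
    ∃ C : Subgroup ↥(unitaryGroupOfForm σ J), (C : Set ↥(unitaryGroupOfForm σ J)) =
      {m : ↥(unitaryGroupOfForm σ J) | m ∈ torusU σ J ∧ (m : GL (Fin 2) K) ∈ congruenceGL 2 δ} :=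
  ⟨torusU σ J ⊓ (congruenceGL 2 δ).comap (unitaryGroupOfForm σ J).subtype, by
    ext m
    simp only [Subgroup.coe_inf, Subgroup.coe_comap, Set.mem_inter_iff, SetLike.mem_coe, Set.mem_preimage, Subgroup.coe_subtype, Set.mem_setOf_eq]⟩

/-- Monotonicity of the lower box in the radius. [cite: Casselman1995, Prop. 1.4.4] -/
theorem lowerBox_mono {r r' : ValueGroupWithZero K} (h : r ≤ r') :
    {x : ↥(unitaryGroupOfForm σ J) | ((x : GL (Fin 2) K) : Matrix (Fin 2) (Fin 2) K) = !![1, 0; ((x : GL (Fin 2) K) : Matrix (Fin 2) (Fin 2) K) 1 0, 1] ∧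
        valuation K (((x : GL (Fin 2) K) : Matrix (Fin 2) (Fin 2) K) 1 0) ≤ r} ⊆
      {x : ↥(unitaryGroupOfForm σ J) | ((x : GL (Fin 2) K) : Matrix (Fin 2) (Fin 2) K) = !![1, 0; ((x : GL (Fin 2) K) : Matrix (Fin 2) (Fin 2) K) 1 0, 1] ∧
        valuation K (((x : GL (Fin 2) K) : Matrix (Fin 2) (Fin 2) K) 1 0) ≤ r'} :=
  fun _ hx => ⟨hx.1, hx.2.trans h⟩

/-- Monotonicity of the upper box in the radius. [cite: Casselman1995, Prop. 1.4.4] -/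
theorem upperBox_mono {r r' : ValueGroupWithZero K} (h : r ≤ r') :
    {x : ↥(unitaryGroupOfForm σ J) | ((x : GL (Fin 2) K) : Matrix (Fin 2) (Fin 2) K) = !![1, ((x : GL (Fin 2) K) : Matrix (Fin 2) (Fin 2) K) 0 1; 0, 1] ∧
        valuation K (((x : GL (Fin 2) K) : Matrix (Fin 2) (Fin 2) K) 0 1) ≤ r} ⊆
      {x : ↥(unitaryGroupOfForm σ J) | ((x : GL (Fin 2) K) : Matrix (Fin 2) (Fin 2) K) = !![1, ((x : GL (Fin 2) K) : Matrix (Fin 2) (Fin 2) K) 0 1; 0, 1] ∧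
        valuation K (((x : GL (Fin 2) K) : Matrix (Fin 2) (Fin 2) K) 0 1) ≤ r'} :=
  fun _ hx => ⟨hx.1, hx.2.trans h⟩

omit [ValuativeRel K] in
/-- A subgroup pinned by a smaller box carrier lies below the one pinned by a larger box carrier (for FILE 1's `hA₀ : A₀ ≤ A`, `hB₀ : B₀ ≤ B`). [cite: DummitFoote2004, §3.3] -/
theorem le_of_coe_eq_of_subset {A₀ A : Subgroup ↥(unitaryGroupOfForm σ J)} {S₀ S : Set ↥(unitaryGroupOfForm σ J)}
    (hA₀ : (A₀ : Set ↥(unitaryGroupOfForm σ J)) = S₀) (hA : (A : Set ↥(unitaryGroupOfForm σ J)) = S) (hS : S₀ ⊆ S) : A₀ ≤ A := by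
  intro x hx
  rw [← SetLike.mem_coe, hA]
  rw [← SetLike.mem_coe, hA₀] at hx
  exact hS hx

end Valued

end Summit.HodgeConjecture.HodgeConjecture.Cruxes.H413.F0P3cStCharTSUpTrU2BoxProductIndex
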